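import Literature.AnabelianGeometry.EtaleTheta.SettingModelKrullCuspCommTerminalC
import HarnessLib

/-!
# The cusped untwisted Krull model, file K9: the admissible choice `ε_Z := a·b` OF RECORD for `inversionModelκ′`
# (the «unique cusp of `Ċ`» configuration of print), by name — model repair R439

S. Mochizuki, *The étale theta function and its Frobenioid-theoretic manifestations*, Publ. RIMS **45** (2009) [EtTh], Def. 1.7,
PRIMS PDF p. 27 (printed 253): «a nontrivial element `ε_Z ∈ Gal(Ẍ/X)` which is `≠ ε_μ`», «`Ẍ^log → Ẋ^log` … the quotient by the
action of `ε_Z`», «`Ẋ^log → Ċ^log` … by the action of `ε_± · ε_μ`»; [SemiAnbd] Thm. 6.5 (ii) p. 71 (commensurable terminality of cusp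
decomposition groups) [cite: MochizukiEtTh2009, Def 1.7 p.27]. Cell abc-iut, layer L2, seat abc-iut-L2-t10 (gen 6), Krull row K9 =
abc-iut-L2-lead R439 «MODEL REPAIR OF RECORD: add the a·b-class variant BY A NEW NAME».

WHY. K5b's `MuTwoSetting.inversionModelκ′` declares `ε_Z := a` (`epsZInvκ`); abc-iut-L2-t5 g7's C-level C7d verdict
(`SettingModelKrullCuspCommTerminalC`, p450247 ✓) shows that the census clause C7d («the cusp decomposition group of `Ċ` is
commensurably terminal») FAILS for that class (`Ċ` gets an orbifold cusp: `Γ₀·ε_± ∈ Π^tp_Ċ`) and HOLDS for the other admissible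
class `ε_Z ≡ a·b` (print's «unique cusp of `Ċ`» configuration). `ε_Z` is NOT a field of the frozen `MuTwoSetting` (only the
predicate `IsAdmissibleEpsZ`), so no landed definition is edited: this file NAMES the print-matching choice and re-keys abc-iut-L2-t5's
theorems on it BY NAME —
* `epsZabInvκ p := inclX (inl (a·b))` (DEFINED), `inversionModelκ'_isAdmissibleEpsZ_ab` (= `isAdmissibleEpsZ_abκ`), `dotXabκ` /
  `dotCabκ` (`rfl` abbreviations of `dotX` / `dotC` at it);
* **`commTerminalC_epsZabInvκ`** (C7d HOLDS for `Π^tp_Ċ := dotC (a·b)`: = `commTerminalC_inversionModelκ'_epsZab`); for the declared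
  `ε_Z := a` C7d FAILS — abc-iut-L2-t5's `not_commTerminalC_inversionModelκ'_epsZInvκ`, cited BY NAME (not restated);
* census headline `exists_isAdmissibleEpsZ_commTerminalC_inversionModelκ'`: the MODEL OF RECORD matching print is
  (`inversionModelκ′`, `ε_Z := a·b`); the `ε_Z := a` variant stays as documented negative knowledge.
HONEST LIMITS: semi-synthetic model (untwisted Galois action) = consistency evidence for the typed interface only; class (b): one
definition (`epsZabInvκ`) + two `abbrev`s, no instance, no `Prop` fact, no interface clause touched; nothing of [EtTh]/[SemiAnbd]
asserted; no side taken on [IUTchIII] Cor. 3.12; typed ≠ proved; instantiated ≠ endorsed.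
-/

noncomputable section

namespace Literature.AnabelianGeometry.EtaleTheta.SettingModel

open Literature.AnabelianGeometry.SemiGraphs Literature.AnabelianGeometry.AbsoluteAnabelian
open scoped Pointwise

variable (p : ℕ) [Fact p.Prime]

/-- **`ε_Z := a·b` read in `Π^tp_C = Π^tp_X ⋊_ι ℤ/2` of the cusped untwisted Krull model** — the admissible class for which
print's «unique cusp of `Ċ`» configuration holds (abc-iut-L2-t5 g7). DEFINED. [cite: MochizukiEtTh2009, Def 1.7 p.27] -/
def epsZabInvκ : PiCInvκ p :=
  (MuTwoSetting.inversionModelκ' p).inclX (SemidirectProduct.inl (gfpOf (FreeGroup.of 0 * FreeGroup.of 1)))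

/-- [cite: MochizukiEtTh2009, Def 1.7 p.27] -/
theorem epsZabInvκ_eq :
    epsZabInvκ p = (MuTwoSetting.inversionModelκ' p).inclX (SemidirectProduct.inl (gfpOf (FreeGroup.of 0 * FreeGroup.of 1))) :=
  rfl

/-- **`ε_Z := a·b` is admissible** at `inversionModelκ′` (`a·b ∉ Π^tp_Ẍ`, `a·b·b⁻¹ = a ∉ Π^tp_Ẍ` — abc-iut-L2-t5's
`isAdmissibleEpsZ_abκ` BY NAME). [cite: MochizukiEtTh2009, Def 1.7 p.27] -/
theorem _root_.Literature.AnabelianGeometry.EtaleTheta.MuTwoSetting.inversionModelκ'_isAdmissibleEpsZ_ab :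
    (MuTwoSetting.inversionModelκ' p).IsAdmissibleEpsZ (epsZabInvκ p) :=
  isAdmissibleEpsZ_abκ p

/-- `Π^tp_Ẋ := Π^tp_Ẍ·⟨ε_Z⟩` for `ε_Z := a·b` (Def. 1.7 «quotient by the action of `ε_Z`»). [cite: MochizukiEtTh2009, Def 1.7 p.27] -/
abbrev dotXabκ : Subgroup (PiCInvκ p) := (MuTwoSetting.inversionModelκ' p).dotX (epsZabInvκ p)

/-- `Π^tp_Ċ := Π^tp_Ẋ·⟨ε_±·ε_μ⟩` for `ε_Z := a·b` (Def. 1.7 «type `(1, μ₂)±`»). [cite: MochizukiEtTh2009, Def 1.7 p.27] -/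
abbrev dotCabκ : Subgroup (PiCInvκ p) := (MuTwoSetting.inversionModelκ' p).dotC (epsZabInvκ p)

/-- `Π^tp_Ẋ` / `Π^tp_Ċ` for `ε_Z := a·b` are of Def. 1.7's types `(1, μ₂)` / `(1, μ₂)±`. [cite: MochizukiEtTh2009, Def 1.7 p.27] -/
theorem isOfTypeOneMuTwo_dotXabκ :
    (MuTwoSetting.inversionModelκ' p).IsOfTypeOneMuTwo (dotXabκ p) ∧
      (MuTwoSetting.inversionModelκ' p).IsOfTypeOneMuTwoPM (dotCabκ p) :=
  ⟨⟨_, MuTwoSetting.inversionModelκ'_isAdmissibleEpsZ_ab p, rfl⟩, ⟨_, MuTwoSetting.inversionModelκ'_isAdmissibleEpsZ_ab p, rfl⟩⟩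

/-- **C7d HOLDS for `ε_Z := a·b`**: every `g ∈ Π^tp_Ċ = dotC (a·b)` commensurating `inclX(D_x)` (the commutator-axis cusp
decomposition group) lies in `inclX(D_x)` — abc-iut-L2-t5 g7's `commTerminalC_inversionModelκ'_epsZab` BY NAME («unique cusp of
`Ċ`»; [SemiAnbd] Thm. 6.5 (ii) shape at the `C`-level). [cite: MochizukiSemiAnbd2006, Thm 6.5 (ii) p.71] -/
theorem commTerminalC_epsZabInvκ :
    ∀ g ∈ dotCabκ p,
      Subgroup.Commensurable (MulAut.conj g • (cuspDecompκ p).map (MuTwoSetting.inversionModelκ' p).inclX)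
          ((cuspDecompκ p).map (MuTwoSetting.inversionModelκ' p).inclX) →
        g ∈ (cuspDecompκ p).map (MuTwoSetting.inversionModelκ' p).inclX :=
  commTerminalC_inversionModelκ'_epsZab p

/-- **CENSUS HEADLINE (R439 model repair of record).** At `inversionModelκ′` the admissible choice `ε_Z := a·b` (`epsZabInvκ`) makes
the C-level C7d clause HOLD — the model of record matching print is (`inversionModelκ′`, `ε_Z := a·b`).
[cite: MochizukiEtTh2009, Def 1.7 p.27] -/
theorem exists_isAdmissibleEpsZ_commTerminalC_inversionModelκ' :
    ∃ εZ : (MuTwoSetting.inversionModelκ' p).GtpC, εZ = epsZabInvκ p ∧ (MuTwoSetting.inversionModelκ' p).IsAdmissibleEpsZ εZ ∧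
      ∀ g ∈ (MuTwoSetting.inversionModelκ' p).dotC εZ,
        Subgroup.Commensurable (MulAut.conj g • (cuspDecompκ p).map (MuTwoSetting.inversionModelκ' p).inclX)
            ((cuspDecompκ p).map (MuTwoSetting.inversionModelκ' p).inclX) →
          g ∈ (cuspDecompκ p).map (MuTwoSetting.inversionModelκ' p).inclX :=
  ⟨epsZabInvκ p, rfl, MuTwoSetting.inversionModelκ'_isAdmissibleEpsZ_ab p, commTerminalC_epsZabInvκ p⟩

end Literature.AnabelianGeometry.EtaleTheta.SettingModel

end
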